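import Mathlib
import HarnessLib
import Literature.NumberTheory.LFunctions.ConnesProlateGuessError

/-!
# Route `SmoothSectorHardy` — the Mellin transform between two abscissae of absolute convergence
# (toolkit for K1a `ProfileMellinFormula`, stmt-RiemannHypothesis-21565)

Two standard facts about Mathlib's `mellin f s = ∫_{(0,∞)} t^{s−1} • f t` stated with
INTEGRABILITY hypotheses (absolute convergence at two real abscissae `σ₁ ≤ σ₂`) instead of the
pointwise `O(x^{−a})`/`O(x^{−b})` hypotheses of Mathlib's `mellin_differentiableAt_of_isBigO_rpow`:

* `mellinConvergent_of_mem_strip` — absolute convergence at every `s` with `σ₁ ≤ Re s ≤ σ₂`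
  (domination by `(t^{σ₁−1} + t^{σ₂−1})‖f t‖`, the elementary `t^c ≤ t^a + t^b` being the tree's
  `Literature.NumberTheory.LFunctions.rpow_le_rpow_add_rpow`);
* `continuousOn_mellin_strip` — `mellin f` is continuous on the CLOSED strip `σ₁ ≤ Re s ≤ σ₂`
  (dominated convergence);
* `differentiableAt_mellin_strip` — `mellin f` is complex-differentiable at every point of the
  OPEN strip `σ₁ < Re s < σ₂` (dominated differentiation, `|log t| ≤ (t^δ + t^{−δ})/δ`).

These are what the continuation of Müntz's formula to the line `Re w = −1/2` needs when only the
absolute convergence of the profile's Mellin integral ON that line is assumed (item 21565, rev 1).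
Mathlib only.  RH-free; nothing here bears on the truth of RH.
-/

set_option linter.dupNamespace false

noncomputable section

namespace Summit.RiemannHypothesis.RiemannHypothesis.Theorems.SmoothSectorHardy

open MeasureTheory Set Filter Complex Topology
open Literature.NumberTheory.LFunctions (rpow_le_rpow_add_rpow)

variable {E : Type*} [NormedAddCommGroup E] [NormedSpace ℂ E]

/-- The pointwise domination on a closed strip: for `t > 0` and `σ₁ ≤ Re s ≤ σ₂`,
`‖t^{s−1} • f t‖ ≤ (t^{σ₁−1} + t^{σ₂−1}) ‖f t‖`. [folklore] -/
theorem norm_cpow_smul_le_of_mem_strip {f : ℝ → E} {σ₁ σ₂ : ℝ} {s : ℂ} (h1 : σ₁ ≤ s.re)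
    (h2 : s.re ≤ σ₂) {t : ℝ} (ht : 0 < t) :
    ‖(t : ℂ) ^ (s - 1) • f t‖ ≤ (t ^ (σ₁ - 1) + t ^ (σ₂ - 1)) * ‖f t‖ := by
  rw [norm_smul, Complex.norm_cpow_eq_rpow_re_of_pos ht, Complex.sub_re, Complex.one_re]
  exact mul_le_mul_of_nonneg_right (rpow_le_rpow_add_rpow ht (by linarith) (by linarith))
    (norm_nonneg _)

/-- The dominating function `(t^{σ₁−1} + t^{σ₂−1})‖f t‖` is integrable on `(0,∞)` when the Mellin
integral converges absolutely at `σ₁` and at `σ₂`. [folklore] -/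
theorem integrableOn_strip_bound {f : ℝ → E} {σ₁ σ₂ : ℝ}
    (hσ₁ : MellinConvergent f (σ₁ : ℂ)) (hσ₂ : MellinConvergent f (σ₂ : ℂ)) :
    IntegrableOn (fun t : ℝ => (t ^ (σ₁ - 1) + t ^ (σ₂ - 1)) * ‖f t‖) (Ioi 0) := by
  have e : ∀ σ : ℝ, ∀ t ∈ Ioi (0:ℝ), ‖(t : ℂ) ^ ((σ : ℂ) - 1) • f t‖ = t ^ (σ - 1) * ‖f t‖ := by
    intro σ t ht
    rw [norm_smul, Complex.norm_cpow_eq_rpow_re_of_pos ht]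
    simp
  have i1 : IntegrableOn (fun t : ℝ => t ^ (σ₁ - 1) * ‖f t‖) (Ioi 0) :=
    (hσ₁.norm).congr ((ae_restrict_mem measurableSet_Ioi).mono fun t ht => e σ₁ t ht)
  have i2 : IntegrableOn (fun t : ℝ => t ^ (σ₂ - 1) * ‖f t‖) (Ioi 0) :=
    (hσ₂.norm).congr ((ae_restrict_mem measurableSet_Ioi).mono fun t ht => e σ₂ t ht)
  exact (i1.add i2).congr_fun (fun t _ => by simp only [Pi.add_apply]; ring) measurableSet_Ioi

/-- The Mellin integrand `t ↦ t^{s−1} • f t` is a.e. strongly measurable on `(0,∞)` when `f` is.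
[folklore] -/
theorem aestronglyMeasurable_cpow_smul {f : ℝ → E}
    (hf : AEStronglyMeasurable f (volume.restrict (Ioi 0))) (s : ℂ) :
    AEStronglyMeasurable (fun t : ℝ => (t : ℂ) ^ (s - 1) • f t) (volume.restrict (Ioi 0)) := by
  refine AEStronglyMeasurable.smul ?_ hf
  refine ContinuousOn.aestronglyMeasurable (fun t ht => ?_) measurableSet_Ioi
  exact (Complex.continuousAt_ofReal_cpow_const t (s - 1) (Or.inr (ne_of_gt ht))).continuousWithinAt

/-- **Absolute convergence on the closed strip.** If the Mellin integral of `f` converges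
absolutely at the real abscissae `σ₁` and `σ₂`, it converges absolutely at every `s` with
`σ₁ ≤ Re s ≤ σ₂`. [folklore] -/
theorem mellinConvergent_of_mem_strip {f : ℝ → E} {σ₁ σ₂ : ℝ}
    (hf : AEStronglyMeasurable f (volume.restrict (Ioi 0)))
    (hσ₁ : MellinConvergent f (σ₁ : ℂ)) (hσ₂ : MellinConvergent f (σ₂ : ℂ)) {s : ℂ}
    (h1 : σ₁ ≤ s.re) (h2 : s.re ≤ σ₂) : MellinConvergent f s := by
  refine (integrableOn_strip_bound hσ₁ hσ₂).mono' (aestronglyMeasurable_cpow_smul hf s) ?_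
  exact (ae_restrict_mem measurableSet_Ioi).mono fun t ht => norm_cpow_smul_le_of_mem_strip h1 h2 ht

/-- **Continuity on the closed strip** (dominated convergence): under the same hypotheses
`mellin f` is continuous on `{s | σ₁ ≤ Re s ≤ σ₂}`. [folklore] -/
theorem continuousOn_mellin_strip [CompleteSpace E] {f : ℝ → E} {σ₁ σ₂ : ℝ}
    (hf : AEStronglyMeasurable f (volume.restrict (Ioi 0)))
    (hσ₁ : MellinConvergent f (σ₁ : ℂ)) (hσ₂ : MellinConvergent f (σ₂ : ℂ)) :
    ContinuousOn (mellin f) {s : ℂ | σ₁ ≤ s.re ∧ s.re ≤ σ₂} := by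
  unfold mellin
  refine continuousOn_of_dominated (fun s _ => aestronglyMeasurable_cpow_smul hf s) ?_
    (integrableOn_strip_bound hσ₁ hσ₂) ?_
  · intro s hs
    exact (ae_restrict_mem measurableSet_Ioi).mono fun t ht =>
      norm_cpow_smul_le_of_mem_strip hs.1 hs.2 ht
  · refine (ae_restrict_mem measurableSet_Ioi).mono fun t ht => ?_
    have htc : (t : ℂ) ≠ 0 := Complex.ofReal_ne_zero.mpr (ne_of_gt ht)
    refine Continuous.continuousOn ?_
    exact ((continuous_id.sub continuous_const).const_cpow (Or.inl htc)).smul continuous_const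

/-- `|log t| ≤ (t^δ + t^{−δ})/δ` for `t > 0`, `δ > 0`. [folklore] -/
theorem abs_log_le_rpow_add_rpow_div {t δ : ℝ} (ht : 0 < t) (hδ : 0 < δ) :
    |Real.log t| ≤ (t ^ δ + t ^ (-δ)) / δ := by
  have h1 : Real.log t ≤ t ^ δ / δ := Real.log_le_rpow_div ht.le hδ
  have h2 : -Real.log t ≤ t ^ (-δ) / δ := by
    have h := Real.log_le_rpow_div (inv_nonneg.mpr ht.le) hδ
    rw [Real.log_inv, Real.inv_rpow ht.le, ← Real.rpow_neg ht.le] at h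
    exact h
  have hp1 : 0 ≤ t ^ δ / δ := by positivity
  have hp2 : 0 ≤ t ^ (-δ) / δ := by positivity
  rw [abs_le, add_div]
  constructor <;> linarith

/-- **Holomorphy on the open strip** (dominated differentiation): under the same hypotheses
`mellin f` is complex-differentiable at every `s` with `σ₁ < Re s < σ₂`. [folklore] -/
theorem differentiableAt_mellin_strip [CompleteSpace E] {f : ℝ → E} {σ₁ σ₂ : ℝ}
    (hf : AEStronglyMeasurable f (volume.restrict (Ioi 0)))
    (hσ₁ : MellinConvergent f (σ₁ : ℂ)) (hσ₂ : MellinConvergent f (σ₂ : ℂ)) {s : ℂ}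
    (h1 : σ₁ < s.re) (h2 : s.re < σ₂) : DifferentiableAt ℂ (mellin f) s := by
  -- radius
  set δ : ℝ := min (s.re - σ₁) (σ₂ - s.re) / 2 with hδ
  have hδ0 : 0 < δ := by
    have : 0 < min (s.re - σ₁) (σ₂ - s.re) := lt_min (by linarith) (by linarith)
    rw [hδ]; linarith
  have hδ1 : 2 * δ ≤ s.re - σ₁ := by
    have : min (s.re - σ₁) (σ₂ - s.re) ≤ s.re - σ₁ := min_le_left _ _
    rw [hδ]; linarith
  have hδ2 : 2 * δ ≤ σ₂ - s.re := by
    have : min (s.re - σ₁) (σ₂ - s.re) ≤ σ₂ - s.re := min_le_right _ _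
    rw [hδ]; linarith
  set F : ℂ → ℝ → E := fun z t => (t : ℂ) ^ (z - 1) • f t with hF
  set F' : ℂ → ℝ → E := fun z t => ((t : ℂ) ^ (z - 1) * Real.log t) • f t with hF'
  set bound : ℝ → ℝ := fun t => (2 / δ) * ((t ^ (σ₁ - 1) + t ^ (σ₂ - 1)) * ‖f t‖) with hbound
  have h_meas : ∀ᶠ z in 𝓝 s, AEStronglyMeasurable (F z) (volume.restrict (Ioi 0)) :=
    Eventually.of_forall fun z => aestronglyMeasurable_cpow_smul hf z
  have h_int : Integrable (F s) (volume.restrict (Ioi 0)) :=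
    mellinConvergent_of_mem_strip hf hσ₁ hσ₂ h1.le h2.le
  have h_meas' : AEStronglyMeasurable (F' s) (volume.restrict (Ioi 0)) := by
    refine AEStronglyMeasurable.smul ?_ hf
    refine ContinuousOn.aestronglyMeasurable (fun t ht => ?_) measurableSet_Ioi
    refine ContinuousAt.continuousWithinAt ?_
    refine (Complex.continuousAt_ofReal_cpow_const t (s - 1) (Or.inr (ne_of_gt ht))).mul ?_
    exact Complex.continuous_ofReal.continuousAt.comp (Real.continuousAt_log (ne_of_gt ht))
  have h_bound : ∀ᵐ t ∂(volume.restrict (Ioi 0)), ∀ z ∈ Metric.ball s δ, ‖F' z t‖ ≤ bound t := by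
    refine (ae_restrict_mem measurableSet_Ioi).mono fun t ht z hz => ?_
    have ht0 : 0 < t := ht
    rw [hF', hbound]
    simp only
    rw [norm_smul, norm_mul, Complex.norm_cpow_eq_rpow_re_of_pos ht0, Complex.norm_real,
      Real.norm_eq_abs, Complex.sub_re, Complex.one_re]
    -- `Re z` is within `δ` of `Re s`
    have hz' : |z.re - s.re| < δ := by
      rw [mem_ball_iff_norm] at hz
      calc |z.re - s.re| = |(z - s).re| := by rw [Complex.sub_re]
        _ ≤ ‖z - s‖ := Complex.abs_re_le_norm _
        _ < δ := hz
    rw [abs_lt] at hz'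
    have hlog := abs_log_le_rpow_add_rpow_div ht0 hδ0
    have hA : t ^ (z.re - 1) * |Real.log t| ≤ (t ^ (z.re - 1 + δ) + t ^ (z.re - 1 - δ)) / δ := by
      calc t ^ (z.re - 1) * |Real.log t| ≤ t ^ (z.re - 1) * ((t ^ δ + t ^ (-δ)) / δ) :=
            mul_le_mul_of_nonneg_left hlog (Real.rpow_nonneg ht0.le _)
        _ = (t ^ (z.re - 1 + δ) + t ^ (z.re - 1 - δ)) / δ := by
            rw [Real.rpow_add ht0, Real.rpow_sub ht0 _ δ, Real.rpow_neg ht0.le]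
            field_simp
    have hB1 : t ^ (z.re - 1 + δ) ≤ t ^ (σ₁ - 1) + t ^ (σ₂ - 1) :=
      rpow_le_rpow_add_rpow ht0 (by linarith) (by linarith)
    have hB2 : t ^ (z.re - 1 - δ) ≤ t ^ (σ₁ - 1) + t ^ (σ₂ - 1) :=
      rpow_le_rpow_add_rpow ht0 (by linarith) (by linarith)
    calc t ^ (z.re - 1) * |Real.log t| * ‖f t‖
        ≤ ((t ^ (z.re - 1 + δ) + t ^ (z.re - 1 - δ)) / δ) * ‖f t‖ :=
          mul_le_mul_of_nonneg_right hA (norm_nonneg _)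
      _ ≤ ((t ^ (σ₁ - 1) + t ^ (σ₂ - 1) + (t ^ (σ₁ - 1) + t ^ (σ₂ - 1))) / δ) * ‖f t‖ := by
          apply mul_le_mul_of_nonneg_right _ (norm_nonneg _)
          exact div_le_div_of_nonneg_right (add_le_add hB1 hB2) hδ0.le
      _ = 2 / δ * ((t ^ (σ₁ - 1) + t ^ (σ₂ - 1)) * ‖f t‖) := by
          field_simp
          ring
  have h_bint : Integrable bound (volume.restrict (Ioi 0)) :=
    (integrableOn_strip_bound hσ₁ hσ₂).const_mul (2 / δ)
  have h_deriv : ∀ᵐ t ∂(volume.restrict (Ioi 0)), ∀ z ∈ Metric.ball s δ,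
      HasDerivAt (fun z => F z t) (F' z t) z := by
    refine (ae_restrict_mem measurableSet_Ioi).mono fun t ht z _ => ?_
    have ht' : (t : ℂ) ≠ 0 := Complex.ofReal_ne_zero.mpr (ne_of_gt ht)
    have u1 : HasDerivAt (fun z : ℂ => (t : ℂ) ^ (z - 1)) ((t : ℂ) ^ (z - 1) * Complex.log t) z := by
      have h := ((hasDerivAt_id' z).sub_const 1).const_cpow (Or.inl ht')
      simpa using h
    rw [hF']
    have e : Complex.log t = ((Real.log t : ℝ) : ℂ) := (Complex.ofReal_log (le_of_lt ht)).symm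
    simp only
    rw [← e]
    exact u1.smul_const (f t)
  have main := hasDerivAt_integral_of_dominated_loc_of_deriv_le (Metric.ball_mem_nhds _ hδ0)
    h_meas h_int h_meas' h_bound h_bint h_deriv
  exact main.2.differentiableAt

end Summit.RiemannHypothesis.RiemannHypothesis.Theorems.SmoothSectorHardy

end
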